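import Literature.AlgebraicGeometry.HodgeTheory.AlgebraicClassesPullback
import Literature.AlgebraicGeometry.HodgeTheory.AlgebraicCyclesDefinedOverQbar
import Literature.AlgebraicGeometry.HodgeTheory.SupportedClassesGysinSpan
import Literature.AlgebraicGeometry.Resolution.ZariskiProjectiveBundle
import HarnessLib

/-!
# Deformation to the normal cone on the coniveau carrier, I: the CONSTANT LIFT
# (Fulton 1998 §5.1, §6.2, Cor. 19.2 (b): pull-back of algebraic classes, from a deformation datum
# and the section pull-back)

Topic `Literature/AlgebraicGeometry/HodgeTheory`. THEOREMS ONLY (no definition, no named fact), on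
the tree's carriers `complexBetti`, `complexBetti.restrictCompl`, `supportedClasses`,
`algebraicClasses X p = Nᵖ H²ᵖ(X(ℂ); ℂ)`, `complexGysin`, `Resolution.IsZariskiProjectiveBundle`.

The printed proof of "`cl` commutes with `f^*` for morphisms of non-singular varieties" (W. Fulton,
*Intersection Theory*, Cor. 19.2 (b), via Prop. 19.2 and Thm. 19.2; C. Voisin, *Hodge Theory II*,
Prop. 9.21 (i)) reduces to a closed immersion `i : X ↪ Y` (graph of the morphism) and then deforms
`Y` to the normal cone of `X` (Fulton §5.1): `M = Bl_{X × {t₁}}(Y × ℙ¹) → Y × ℙ¹`, with the strict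
transform `J : X × ℙ¹ → M` of `X × ℙ¹` and the exceptional divisor `k : E = ℙ(N ⊕ 𝟙) → M`, a
Zariski `ℙʳ`-bundle `q : E → X` with the section `s` at infinity. On the support carrier
`Nᵖ H²ᵖ = Σ_Z ker (H²ᵖ(Y) → H²ᵖ(Y ∖ Z))` (closed `Z` of codimension `≥ p`) the specialisation of a
class `c` dying off `Z` is done here by the CONSTANT LIFT `C := φ^* c` along the structure map
`φ : M → Y`, which needs no multiplicities:

* `C` dies off `Z̄ ∪ k(E)` whenever `φ⁻¹ Z ⊆ Z̄ ∪ k(E)`; by Deligne (Hodge III, Cor. 8.2.8) and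
  Hironaka — the tree's theorems `Deligne1974_ker_restrictCompl_eq_iSup_range_complexGysin_holds`,
  `exists_family_iUnion_range_eq_of_isClosed` — `C = w + v` with `w` dying off `Z̄` and `v = k_* u`
  dying off `k(E)` (`exists_add_of_restrictCompl_union_range_eq_zero`);
* `i^* c = (ι_{t₀} ≫ J)^* C = (ι_{t₀} ≫ J)^* w`, because the slice at `t₀` misses `k(E)`
  (`map_eq_zero_of_disjoint`);
* `(ι_{t₀} ≫ J)^* w = (ι_{t₁} ≫ J)^* w = s^*(k^* w)` by the homotopy invariance of slices
  (`complexBetti_map_sliceAt_eq_of_pathConnectedSpace`), and `k^* w` dies off `k⁻¹ Z̄`, of codimension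
  `≥ p` in `E`, so `k^* w ∈ Nᵖ H²ᵖ(E)` and `s^*(k^* w) ∈ Nᵖ H²ᵖ(X)` by the section pull-back.

PROVED here, with the two geometric inputs as displayed hypotheses (section `Composition`):
`hD` — the CONSTANT-LIFT DEFORMATION DATUM of a closed immersion of smooth projective varieties
(constructed in `DeformationToNormalConeDatum.exists_constantLiftDatum`), and `hSec` — the SECTION
PULL-BACK for Zariski `ℙʳ`-bundles (proved in
`ZariskiProjectiveBundleSectionPullback`, `ZariskiProjectiveBundle.map_section_mem_algebraicClasses`):

* `ker_le_comap_of_constantLift` — the closed-immersion case;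
* `map_mem_algebraicClasses_of_constantLift` — **the statement of the named fact
  `fulton1998_map_mem_algebraicClasses` (same binders) from `hD` and `hSec`** (graph reduction: `j = γ_j ≫ pr_Y`,
  `pr_Y` flat, `γ_j` a closed immersion of codimension `dim Y ≥ 1`; `dim Y = 0` is trivial).

The two hypotheses are discharged in `AlgebraicClassesPullbackHolds`.

Provenance: Literature home of
`Summits/HodgeConjecture/HodgeConjecture/Theorems/BoundaryReadoutPullbackAlgebraicConstantLift.lean`
(route `BoundaryReadout`, crux `PullbackAlgebraic`, stmt-HodgeConjecture-1071; prover seats of that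
route), with the Zariski-local triviality clauses restated on `Resolution.IsZariskiProjectiveBundle` and
the route decls replaced by the Literature fact they restate.

## References

* [Fulton1998] W. Fulton, Intersection Theory, 2nd ed. (1998), §5.1, §6.2, Ex. 19.2.1, §19.2
  Prop. 19.2 and Cor. 19.2 (b).
* [DeligneHodgeIII1974] P. Deligne, Théorie de Hodge III, Cor. 8.2.8.
* [VoisinHodgeII2003] C. Voisin, Hodge Theory and Complex Algebraic Geometry II (2003), Prop. 9.21 (i).
* [Kollar2007] J. Kollár, Lectures on Resolution of Singularities (2007), Thm. 3.27.
* [GrothendieckTopology1969] A. Grothendieck, Hodge's general conjecture is false for trivial reasons,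
  Topology 8 (1969), §1.
-/

noncomputable section

open CategoryTheory AlgebraicGeometry MonoidalCategory CartesianMonoidalCategory
open Literature.AlgebraicGeometry Literature.AlgebraicGeometry.Motives
  Literature.AlgebraicGeometry.Resolution
open Literature.AlgebraicTopology.SingularHomology (gysinMap_restrictCompl_eq_zero_of_field)

namespace Literature.AlgebraicGeometry.HodgeTheory

namespace DeformationToNormalCone

/-! ### Lemmas -/

section Lemmas

variable {n : ℕ} {X : SchemeOver ℂ}

/-- A class dying off the EMPTY set vanishes (restriction to `(X ∖ ∅)(ℂ) = X(ℂ)` is injective on a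
smooth projective `X`: semipurity with an arbitrary codimension bound). [cite: GrothendieckTopology1969, §1] -/
theorem eq_zero_of_restrictCompl_empty_eq_zero (hX : IsSmoothProjective n X) {a : ℕ}
    {x : complexBetti X a} (hx : complexBetti.restrictCompl X ∅ a x = 0) : x = 0 :=
  injective_restrictCompl_of_le_coheight hX isClosed_empty (c := a + 1)
    (fun z hz ↦ (Set.notMem_empty z hz).elim) (i := a) (by omega) (by rw [hx, map_zero])

/-- **A class dying off a subset `S` pulls back to zero along a morphism from a smooth projective
variety missing `S`.** [cite: GrothendieckTopology1969, §1] -/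
theorem map_eq_zero_of_disjoint (hX : IsSmoothProjective n X) {M : SchemeOver ℂ} (g : X ⟶ M)
    {S : Set M.left} (hS : Disjoint (Set.range g.left.base) S) {a : ℕ} {v : complexBetti M a}
    (hv : complexBetti.restrictCompl M S a v = 0) : complexBetti.map g a v = 0 := by
  refine eq_zero_of_restrictCompl_empty_eq_zero hX ?_
  have h := complexBetti.restrictCompl_map_eq_zero g hv
  have he : g.left.base ⁻¹' S = ∅ :=
    Set.eq_empty_of_forall_notMem fun x hx ↦ Set.disjoint_left.1 hS (Set.mem_range_self x) hx
  rwa [he] at h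

/-- **Deligne's decomposition, support form**: on a smooth projective `M`, a class dying off
`Z̄ ∪ k(E)` (`Z̄` Zariski-closed of codimension `≥ p`, `k : E ⟶ M` from a smooth projective `E`) is the
sum of a class dying off `Z̄` and a class dying off `k(E)` — resolve the components of `Z̄`
(`exists_family_iUnion_range_eq_of_isClosed`, Hironaka) and decompose by Deligne's Cor. 8.2.8
(`Deligne1974_ker_restrictCompl_eq_iSup_range_complexGysin_holds`); each Gysin image dies off the range
of its morphism. [cite: DeligneHodgeIII1974, Cor. 8.2.8] [cite: Kollar2007, Thm. 3.27] -/
theorem exists_add_of_restrictCompl_union_range_eq_zero {N dE : ℕ} {M E : SchemeOver ℂ}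
    (hM : IsSmoothProjective N M) (hE : IsSmoothProjective dE E) (k : E ⟶ M) {Zb : Set M.left}
    (hZbc : IsClosed Zb) {p : ℕ} (hZbp : ∀ w ∈ Zb, (p : ℕ∞) ≤ Order.coheight w) {a : ℕ}
    {C : complexBetti M a} (hC : complexBetti.restrictCompl M (Zb ∪ Set.range k.left.base) a C = 0) :
    ∃ w v : complexBetti M a, C = w + v ∧ complexBetti.restrictCompl M Zb a w = 0 ∧
      complexBetti.restrictCompl M (Set.range k.left.base) a v = 0 := by
  classical
  let μ : OrientationFamily := fun _ _ h ↦ (Motives.ComplexPoints.isOrientableOver ℂ h).some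
  have hμ : μ.HasPoincareDuality := OrientationFamily.hasPoincareDuality μ
  have hS := gysinMap_restrictCompl_eq_zero_of_field ℂ
  obtain ⟨ι, _, m, Y, hY, g, hZeq, -⟩ :=
    exists_family_iUnion_range_eq_of_isClosed Resolution.Hironaka1964_projective_holds hM hZbc hZbp
  -- the family `Option ι`: `none ↦ (E, k)`, `some j ↦ (Y j, g j)`
  let m' : Option ι → ℕ := fun o ↦ o.elim dE m
  let Y' : Option ι → SchemeOver ℂ := fun o ↦ o.rec E Y
  have hY' : ∀ o, IsSmoothProjective (m' o) (Y' o) := fun o ↦ by cases o with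
    | none => exact hE
    | some j => exact hY j
  let g' : ∀ o, Y' o ⟶ M := fun o ↦ match o with
    | none => k
    | some j => g j
  have hU : (⋃ o, Set.range (g' o).left.base) = Zb ∪ Set.range k.left.base := by
    ext x
    simp only [Set.mem_iUnion, Set.mem_union]
    constructor
    · rintro ⟨o, ho⟩
      cases o with
      | none => exact Or.inr ho
      | some j => exact Or.inl (hZeq ▸ Set.mem_iUnion.2 ⟨j, ho⟩)
    · rintro (hx | hx)
      · rw [← hZeq] at hx
        obtain ⟨j, hj⟩ := Set.mem_iUnion.1 hx
        exact ⟨some j, hj⟩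
      · exact ⟨none, hx⟩
  have hC' : complexBetti.restrictCompl M (⋃ o, Set.range (g' o).left.base) a C = 0 := by
    rw [hU]; exact hC
  have hmem := Deligne1974_ker_restrictCompl_eq_iSup_range_complexGysin_holds.mem_iSup_range μ hμ
    hM hY' g' hC'
  -- each Gysin image dies off the range of its morphism
  have hle : (⨆ (o : Option ι) (b : ℕ) (hab : b + 2 * N = a + 2 * m' o),
      LinearMap.range (complexGysin μ (hY' o) hM (g' o) hab)) ≤
      LinearMap.ker (complexBetti.restrictCompl M Zb a).hom ⊔
        LinearMap.ker (complexBetti.restrictCompl M (Set.range k.left.base) a).hom := by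
    refine iSup_le fun o ↦ iSup_le fun b ↦ iSup_le fun hab ↦ ?_
    rintro _ ⟨y, rfl⟩
    have hcl : IsClosed (Set.range (g' o).left.base) := by
      haveI := isProper_left_of_isSmoothProjective (hY' o) hM (g' o)
      exact (g' o).left.isClosedMap.isClosed_range
    have hdie : complexBetti.restrictCompl M (Set.range (g' o).left.base) a
        (complexGysin μ (hY' o) hM (g' o) hab y) = 0 :=
      complexGysin_restrictCompl_eq_zero hS μ hμ (hY' o) hM (g' o) hab hcl y
        (restrictCompl_eq_zero_of_preimage_eq_univ (Set.preimage_range _) _ _)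
    cases o with
    | none => exact Submodule.mem_sup_right (LinearMap.mem_ker.2 hdie)
    | some j =>
      refine Submodule.mem_sup_left (LinearMap.mem_ker.2 ?_)
      refine complexBetti.restrictCompl_eq_zero_of_subset ?_ hdie
      rw [← hZeq]
      exact Set.subset_iUnion (fun j ↦ Set.range (g j).left.base) j
  obtain ⟨w, hw, v, hv, hwv⟩ := Submodule.mem_sup.1 (hle hmem)
  exact ⟨w, v, hwv.symm, LinearMap.mem_ker.1 hw, LinearMap.mem_ker.1 hv⟩

end Lemmas

/-! ### The graph of a morphism to a smooth projective variety -/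

section Graph

variable {X : SchemeOver ℂ}

/-- The graph `(𝟙, j) : X ⟶ X ⊗ W` of a morphism to a smooth projective (hence separated) `W` is a
closed immersion (a section of the separated projection `X ⊗ W → X`; the reduction "introduce the
graph of `i`" of the printed proofs). [cite: Fulton1998, §19.2 proof of Prop. 19.2]
[cite: VoisinHodgeII2003, proof of Prop. 9.21 (i)] -/
theorem isClosedImmersion_graph_left {m : ℕ} {W : SchemeOver ℂ} (hW : IsSmoothProjective m W)
    (j : X ⟶ W) : IsClosedImmersion (CartesianMonoidalCategory.lift (𝟙 X) j).left := by
  haveI : IsProper W.hom := hW.isProjectiveOver.isProper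
  have h : (CartesianMonoidalCategory.lift (𝟙 X) j).left ≫ (fst X W).left = 𝟙 _ := by
    rw [← Over.comp_left, CartesianMonoidalCategory.lift_fst]
    rfl
  haveI : IsSeparated (fst X W).left := inferInstanceAs (IsSeparated (Limits.pullback.fst X.hom W.hom))
  haveI : IsClosedImmersion ((CartesianMonoidalCategory.lift (𝟙 X) j).left ≫ (fst X W).left) := by
    rw [h]
    infer_instance
  exact IsClosedImmersion.of_comp _ (fst X W).left

end Graph

/-! ### The composition: the closed-immersion case, and the fact from the two inputs -/

section Composition

variable {n : ℕ} {X : SchemeOver ℂ}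
  (hD : ∀ ⦃n r : ℕ⦄ ⦃X Y : SchemeOver ℂ⦄ (i : X ⟶ Y), IsSmoothProjective n X →
        IsSmoothProjective (n + r) Y → IsClosedImmersion i.left → 1 ≤ r →
        ∃ (T : SchemeOver ℂ) (t₀ t₁ : AlgPoints T ℂ) (M E : SchemeOver ℂ) (φ : M ⟶ Y)
          (J : X ⊗ T ⟶ M) (k : E ⟶ M) (q : E ⟶ X) (s : X ⟶ E) (Zbar : Set Y.left → Set M.left),
          IsSmoothProjective 1 T ∧ IsSmoothProjective (n + r + 1) M ∧ IsSmoothProjective (n + r) E ∧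
          Motives.sliceAt X t₀ ≫ J ≫ φ = i ∧ s ≫ k = Motives.sliceAt X t₁ ≫ J ∧ s ≫ q = 𝟙 X ∧
          Disjoint (Set.range (Motives.sliceAt X t₀ ≫ J).left.base) (Set.range k.left.base) ∧
          IsZariskiProjectiveBundle r q ∧
          ∀ (p : ℕ) (Z : Set Y.left), IsClosed Z → (∀ z ∈ Z, (p : ℕ∞) ≤ Order.coheight z) →
            IsClosed (Zbar Z) ∧ (∀ w ∈ Zbar Z, (p : ℕ∞) ≤ Order.coheight w) ∧
            φ.left.base ⁻¹' Z ⊆ Zbar Z ∪ Set.range k.left.base ∧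
            ∀ w ∈ k.left.base ⁻¹' Zbar Z, (p : ℕ∞) ≤ Order.coheight w)
  (hSec : ∀ ⦃n r : ℕ⦄ ⦃X E : SchemeOver ℂ⦄ (q : E ⟶ X) (s : X ⟶ E), IsSmoothProjective n X →
        IsSmoothProjective (n + r) E → IsZariskiProjectiveBundle r q → s ≫ q = 𝟙 X →
        ∀ (p : ℕ), ∀ y ∈ algebraicClasses E p, complexBetti.map s (2 * p) y ∈ algebraicClasses X p)

/-! The two hypotheses (displayed as binders of the theorems below):

* `hD` — **the constant-lift deformation datum** (Fulton 1998 §5.1: `T = ℙ¹`,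
  `M = Bl_{i(X) × {t₁}}(Y ⊗ T)`, `φ` = blow-down followed by `pr_Y`, `J` = strict transform of `X × T`,
  `E` = exceptional divisor with projection `q` and section `s` at infinity, `Z̄ Z` = closure of
  `β⁻¹(Z × T) ∖ E`). For a closed immersion `i : X ↪ Y` of smooth projective complex varieties
  (`dim Y = dim X + r`, `r ≥ 1`): a smooth projective curve `T` with two complex points, a smooth
  projective `M` of dimension `n + r + 1` with `φ : M ⟶ Y`, `J : X ⊗ T ⟶ M` with `ι_{t₀} ≫ J ≫ φ = i`, a
  smooth projective `E` of dimension `n + r` with `k : E ⟶ M`, a Zariski `ℙʳ`-bundle `q : E ⟶ X`, a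
  section `s` (`s ≫ q = 𝟙`, `s ≫ k = ι_{t₁} ≫ J`), the slice `ι_{t₀} ≫ J` missing `k(E)`, and for every
  Zariski-closed `Z ⊆ Y` a Zariski-closed `Z̄ ⊆ M` with `φ⁻¹ Z ⊆ Z̄ ∪ k(E)` which has codimension `≥ p`
  in `M` and trace `k⁻¹ Z̄` of codimension `≥ p` in `E` whenever `Z` has codimension `≥ p`
  (`DeformationToNormalConeDatum.exists_constantLiftDatum`);
* `hSec` — **the section pull-back**: the section of a Zariski-locally trivial `ℙʳ`-bundle of smooth
  projective varieties pulls algebraic classes back to algebraic classes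
  (`ZariskiProjectiveBundle.map_section_mem_algebraicClasses`). -/

include hD hSec

/-- **The closed-immersion case from the two inputs.** For a closed immersion `γ : X ↪ V` of smooth
projective varieties with `dim V = dim X + r`, `r ≥ 1`, `γ^*` maps the classes dying off a closed
`Z ⊆ V` of codimension `≥ p` into `algebraicClasses X p`: with the constant-lift datum,
`γ^* c = (ι_{t₀} ≫ J)^*(φ^* c) = (ι_{t₀} ≫ J)^* w = (ι_{t₁} ≫ J)^* w = s^*(k^* w)` for the part `w` of
`φ^* c` dying off `Z̄` (Deligne decomposition; the other part dies off `k(E)`, missed by the slice at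
`t₀`), and `k^* w ∈ Nᵖ(E)`, `s^*(k^* w) ∈ Nᵖ(X)` (section pull-back).
[cite: Fulton1998, §5.1, §6.2 and Ex. 19.2.1] [cite: DeligneHodgeIII1974, Cor. 8.2.8] -/
theorem ker_le_comap_of_constantLift {r : ℕ} {V : SchemeOver ℂ} (hX : IsSmoothProjective n X)
    (hV : IsSmoothProjective (n + r) V) (hr : 1 ≤ r) (γ : X ⟶ V) (hγ : IsClosedImmersion γ.left)
    (p : ℕ) {Z : Set V.left} (hZc : IsClosed Z) (hZp : ∀ z ∈ Z, (p : ℕ∞) ≤ Order.coheight z) :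
    LinearMap.ker (complexBetti.restrictCompl V Z (2 * p)).hom ≤
      (algebraicClasses X p).comap (complexBetti.map γ (2 * p)).hom := by
  obtain ⟨T, t₀, t₁, M, E, φ, J, k, q, s, Zbar, hT, hM, hE, hJφ, hsk, hsq, hdisj, htriv, hZbar⟩ :=
    hD γ hX hV hγ hr
  obtain ⟨hZbc, hZbp, hsub, hZbE⟩ := hZbar p Z hZc hZp
  intro c hc
  rw [Submodule.mem_comap]
  -- the constant lift `C = φ^* c` dies off `Z̄ ∪ k(E)`
  have hC : complexBetti.restrictCompl M (Zbar Z ∪ Set.range k.left.base) (2 * p)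
      (complexBetti.map φ (2 * p) c) = 0 :=
    complexBetti.restrictCompl_eq_zero_of_subset hsub
      (complexBetti.restrictCompl_map_eq_zero φ (LinearMap.mem_ker.1 hc))
  obtain ⟨w, v, hwv, hw, hv⟩ := exists_add_of_restrictCompl_union_range_eq_zero hM hE k hZbc hZbp hC
  -- `γ^* c = (ι_{t₀} ≫ J)^* C = (ι_{t₀} ≫ J)^* w = (ι_{t₁} ≫ J)^* w = s^* (k^* w)`
  haveI : PathConnectedSpace (Motives.ComplexPoints T) :=
    pathConnectedSpace_complexPoints_of_isSmoothProjective' hT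
  have key : (complexBetti.map γ (2 * p)).hom c =
      (complexBetti.map s (2 * p)).hom ((complexBetti.map k (2 * p)).hom w) := by
    have h0 : (complexBetti.map (Motives.sliceAt X t₀ ≫ J) (2 * p)).hom v = 0 :=
      map_eq_zero_of_disjoint hX (Motives.sliceAt X t₀ ≫ J) hdisj hv
    have h0' : (complexBetti.map (Motives.sliceAt X t₀) (2 * p)).hom
        ((complexBetti.map J (2 * p)).hom v) = 0 := by
      rw [← complexBetti.map_comp_apply]; exact h0
    have hslice : complexBetti.map (Motives.sliceAt X t₀) (2 * p) =
        complexBetti.map (Motives.sliceAt X t₁) (2 * p) :=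
      complexBetti_map_sliceAt_eq_of_pathConnectedSpace t₀ t₁ (2 * p)
    rw [← hJφ, complexBetti.map_comp_apply (Motives.sliceAt X t₀) (J ≫ φ),
      complexBetti.map_comp_apply J φ, hwv, map_add, map_add, h0', add_zero,
      ← complexBetti.map_comp_apply s k, hsk, complexBetti.map_comp_apply, hslice]
  -- `k^* w` dies off `k⁻¹ Z̄`, of codimension `≥ p` in `E`
  have hkw : (complexBetti.map k (2 * p)).hom w ∈ algebraicClasses E p :=
    mem_supportedClasses_of_restrictCompl_eq_zero (hZbc.preimage k.left.continuous) hZbE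
      (complexBetti.restrictCompl_map_eq_zero k hw)
  change (complexBetti.map γ (2 * p)).hom c ∈ algebraicClasses X p
  rw [key]
  exact hSec q s hX hE htriv hsq p _ hkw

/-- **The statement of `fulton1998_map_mem_algebraicClasses` (verbatim binders: morphism, target,
source) from the constant-lift datum and the section pull-back**
(Fulton Cor. 19.2 (b) / Prop. 19.2; Voisin II Prop. 9.21 (i), on the coniveau carrier). Given
`j : X ⟶ Y` between smooth projective varieties and `β ∈ Nᵖ H²ᵖ(Y)`: if `dim Y = 0` then
`H²ᵖ(Y(ℂ)) = 0` for `p ≥ 1` and `N⁰ = ⊤`; else `j^* β = γ^*(pr_Y^* β)` for the graph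
`γ = (𝟙, j) : X ↪ X ⊗ Y` (a closed immersion of codimension `dim Y ≥ 1`), `pr_Y^* β ∈ Nᵖ` (`pr_Y` flat,
`map_snd_mem_supportedClasses`), and `Nᵖ H²ᵖ(X ⊗ Y)` is the sum over closed supports of kernels, each
handled by `ker_le_comap_of_constantLift`.
[cite: Fulton1998, §19.2 proof of Prop. 19.2 and Cor. 19.2 (b)] [cite: VoisinHodgeII2003, Prop. 9.21 (i)] -/
theorem map_mem_algebraicClasses_of_constantLift :
    ∀ ⦃m n : ℕ⦄ ⦃Y X : SchemeOver ℂ⦄ (j : X ⟶ Y), IsSmoothProjective m Y → IsSmoothProjective n X →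
      ∀ (p : ℕ), ∀ β ∈ algebraicClasses Y p, complexBetti.map j (2 * p) β ∈ algebraicClasses X p := by
  intro m n Y X j hY hX p β hβ
  rcases Nat.eq_zero_or_pos m with rfl | hm
  · rcases Nat.eq_zero_or_pos p with rfl | hp
    · rw [algebraicClasses_zero]
      exact Submodule.mem_top
    · haveI := subsingleton_complexBetti hY (k := 2 * p) (by omega)
      rw [Subsingleton.elim β 0, map_zero]
      exact Submodule.zero_mem _
  · rw [← complexBetti_map_lift_id_map_snd j (2 * p) β]
    have hV : IsSmoothProjective (n + m) (X ⊗ Y) := IsSmoothProjective.tensor_holds hX hY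
    have hc : complexBetti.map (snd X Y) (2 * p) β ∈ algebraicClasses (X ⊗ Y) p :=
      map_snd_mem_supportedClasses hX hY hβ
    have hγ : IsClosedImmersion (CartesianMonoidalCategory.lift (𝟙 X) j).left :=
      isClosedImmersion_graph_left hY j
    suffices hle : algebraicClasses (X ⊗ Y) p ≤
        (algebraicClasses X p).comap
          (complexBetti.map (CartesianMonoidalCategory.lift (𝟙 X) j) (2 * p)).hom from hle hc
    exact iSup_le fun Z ↦ iSup_le fun hZc ↦ iSup_le fun hZp ↦
      ker_le_comap_of_constantLift hD hSec hX hV hm _ hγ p hZc hZp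

end Composition

end DeformationToNormalCone

end Literature.AlgebraicGeometry.HodgeTheory

end
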